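import Literature.Analysis.FluidPDE.Tao2016AveragedNS.LocalCascadeSolutions
import HarnessLib

/-!
# Tao 2016, §4 and §6: epoch checkpoints, restarted cascade pseudo-flows, front steps and gap data

T. Tao, *Finite time blowup for an averaged three-dimensional Navier–Stokes equation*, J. Amer.
Math. Soc. **29** (2016) 601–674 = arXiv:1402.0290v3 [`Tao2016AveragedNS`]: §4, Lemma 4.1
(conclusions (4.5), (4.8)–(4.10)); §6.2, Proposition 6.3 ((vi)–(ix)) and the deduction of
Theorem 6.2 from it; §6.3, Proposition 6.4 (the inductive step); §6.4, Proposition 6.5 and the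
rescaling `τ_k := (1+ε₀)^{5N/2} e_N (t_{N+k} − t_N)`, `a_k(t) := e_N⁻¹ X_{1,N+k}(t_N + (1+ε₀)^{−5N/2} e_N⁻¹ t)`,
`Ẽ_k(t) := e_N⁻² E_{N+k}(…)`, `t_{N+1} := t_N + (1+ε₀)^{−5N/2} e_N⁻¹ τ₁`, `e_{N+1} := μ₁ e_N`
(arXiv v3 pp. 31–34).

This is the SECOND module of the lattice vocabulary of cell harvest/h2-tao-ladder (definition
request `defn-PseudoFlowOn`, planner theory-1 g6; source: cell file `TaoLadderRung2.lean` v5, sha16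
d4b37cff5cfc6865, re-based on the tree module `LocalCascadeSolutions.lean`). It supplies
PREDICATES AND FUNCTIONS ONLY — nothing is asserted about any table:

* `EpochCheckpoints ε₀ θ c i₀ n₀ X₀ P Q N X E t e` — `ShellCheckpoints … P N X E t e` (tree) together
  with a witness-chosen EPOCH description `Q` of the rescaled state throughout every epoch
  `[t_{n−1}, t_n]` (Tao's (ix) energy estimates are such a `Q`; `Q := ⊤` forgets the epochs:
  `ShellCheckpoints.toEpochCheckpoints`, `EpochCheckpoints.forget`);
* `DynamicsLocalAt ε₀ R` — the single-scale-ratio local robust checkpoint induction ("Prop. 6.4-loc"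
  of the cell) over `CascadeODESolutionOn` and `EpochCheckpoints`, `0 ≤ θ < 5/2`, `c > 0`, table in
  `InTableClass R`;
* `epochEnvelope env` (the epoch description "energies under `env`"), `PseudoFlowOn τ ε₀ α κ₁ κ₂ S₀ F₀
  B₀ S F` — a RESTARTED local pseudo-flow: the displays (4.5), (4.8)–(4.10) at level `0`, amplitude
  `1`, with defect constants `κ₁, κ₂`, an arbitrary start state and an accumulated (4.10)-slack `B₀`
  (this is the shape of Tao's rescaled system, Prop. 6.5 (i), (ii), (iv)); `StepTo` (one checkpoint
  step of a restarted flow); `slackWeight` (the canonical slack envelope, a finite sum);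
  `restartX / restartE / restartSlack` (Tao's rescaling at a checkpoint, §6.4);
* `FrontExists`, `RobustStep` — the two clauses of a robust front step with margin `η`, and the
  single-`ε₀` front step `FrontStepAt ε₀ R` (+ `frontStepAt_iff`);
* `ballDesc Z w r` (+ `ballDesc_of_mem`), the tail clause `TailFat ε₀ Z w r`, and the gap-certificate
  shape `GapData ε₀ i₀ α X₀ Z w r ρ θ₀ θ c₀ c env₀` (+ `GapData.signs`, `GapData.datum_mem_ball`).
* v2 CERTIFICATE FORMAT (definition request `defn-TaoCascade.GapData₂`, planner theory-1 g13; source: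
  cell file `referee/c32_SketchGapData2.lean`, sha16 ded89ae68a5ba905, clause text elaborated rc 0 by
  the cell's referee c32; PURE ADDITIONS, `GapData` untouched): `TameBehind ε₀ Z w` (reference
  amplitudes bounded ahead of the front and growing at most like `(1+ε₀)^{|k|}` behind it, weights
  likewise), `StepSlack σ ε₀ i₀ α Z w r ρ θ₀ c₀ env₀` (the exact step (step₀) of `GapData` with the
  amplitude slack `(1+σ)·a ≤ |S i₀ 1 τ₁|`), `TailCompat ε₀ Z w r env₀` (the two-sided tail clause:
  (T1), (T2) of `TailFat` under ONE threshold together with the envelope scale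
  `env₀ k ≤ K₀ r²/w(k−1)²` and the upper growth `(1+ε₀)^{5(k+2)/2} r w(k+1) ≤ C₄ (w k)²`),
  `GapData₂ σ … := GapData … ∧ 0 < σ ∧ TameBehind ∧ StepSlack ∧ TailCompat`, and the API
  `GapData₂.toGapData`, `TailCompat.tailFat`. The v2 route statements `GappedFrontRobust₂`,
  `ComparableGapCertificates₂` are NOT vendored here (route items, as for v1).

NOT vendored here (they are route items of the cell's routes `Theses/TaoLadderRungThree.lean` and
`Theses/TaoLadderRungTwo.lean`, spelled over these predicates): the closed statements
`GappedFrontRobust`, `DyadicGapCertificate`, `ComparableGapCertificates`, `RestartControl`,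
`RestartGlue`, `LocalDynamicsSufficesAt` and the rung claims. Tables are spelled
`Fin m → Fin m → Fin m → ℤ × ℤ × ℤ → ℝ`. MODEL lattice objects only — nothing in this file is a
statement about the Navier–Stokes equations.
-/

noncomputable section

open Set MeasureTheory intervalIntegral

namespace Literature.Analysis.FluidPDE

namespace TaoCascade

/-! ### Epoch checkpoints (Proposition 6.3 (vi)–(ix) with an epoch description) -/

/-- **Shell checkpoints up to level `N` with an epoch description `Q`**: the data of
`ShellCheckpoints ε₀ θ c i₀ n₀ X₀ P N X E t e` (anchor, amplitudes, transition-state description `P`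
at the checkpoint times, monotone clock with lifespan bound, amplitude ratio) together with a
witness-chosen description `Q` of the rescaled state
`(k ↦ X_{i,n−1+k}(s)/e_{n−1}, k ↦ E_{i,n−1+k}(s)/e_{n−1}²)` at every time `s ∈ [t_{n−1}, t_n]` of every
epoch, `n₀ < n ≤ N` (Tao's (ix): energy estimates relative to level `n−1` throughout the epoch).
[cite: Tao2016AveragedNS, §6.2 Prop. 6.3 (vi)–(ix); cell vocabulary] -/
structure EpochCheckpoints (ε₀ θ c : ℝ) {m : ℕ} (i₀ : Fin m) (n₀ : ℤ) (X₀ : Fin m → ℝ)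
    (P Q : (Fin m → ℤ → ℝ) → (Fin m → ℤ → ℝ) → Prop) (N : ℤ)
    (X E : Fin m → ℤ → ℝ → ℝ) (t e : ℤ → ℝ) : Prop
    extends ShellCheckpoints ε₀ θ c i₀ n₀ X₀ P N X E t e where
  /-- the epoch description holds throughout every epoch `[t_{n-1}, t_n]` (rescaled at level `n-1`). -/
  epoch : ∀ n, n₀ < n → n ≤ N → ∀ s ∈ Icc (t (n - 1)) (t n),
    Q (fun i k => X i (n - 1 + k) s / e (n - 1)) (fun i k => E i (n - 1 + k) s / e (n - 1) ^ 2)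

/-- Epoch checkpoints up to level `N` restrict to any lower level `N' ≤ N`.
[cite: Tao2016AveragedNS, §6.2 Prop. 6.3; cell vocabulary] -/
theorem EpochCheckpoints.mono_level {ε₀ θ c : ℝ} {m : ℕ} {i₀ : Fin m} {n₀ : ℤ} {X₀ : Fin m → ℝ}
    {P Q : (Fin m → ℤ → ℝ) → (Fin m → ℤ → ℝ) → Prop} {N N' : ℤ} {X E : Fin m → ℤ → ℝ → ℝ}
    {t e : ℤ → ℝ} (h : EpochCheckpoints ε₀ θ c i₀ n₀ X₀ P Q N X E t e) (hN' : N' ≤ N) :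
    EpochCheckpoints ε₀ θ c i₀ n₀ X₀ P Q N' X E t e where
  toShellCheckpoints := h.toShellCheckpoints.mono_level hN'
  epoch n h1 h2 := h.epoch n h1 (h2.trans hN')

/-- Forgetting the epoch description. [cite: Tao2016AveragedNS, §6.2 Prop. 6.3; cell vocabulary] -/
theorem EpochCheckpoints.forget {ε₀ θ c : ℝ} {m : ℕ} {i₀ : Fin m} {n₀ : ℤ} {X₀ : Fin m → ℝ}
    {P Q : (Fin m → ℤ → ℝ) → (Fin m → ℤ → ℝ) → Prop} {N : ℤ} {X E : Fin m → ℤ → ℝ → ℝ}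
    {t e : ℤ → ℝ} (h : EpochCheckpoints ε₀ θ c i₀ n₀ X₀ P Q N X E t e) :
    ShellCheckpoints ε₀ θ c i₀ n₀ X₀ P N X E t e :=
  h.toShellCheckpoints

/-- Shell checkpoints are epoch checkpoints for the trivial epoch description `Q := ⊤`.
[cite: Tao2016AveragedNS, §6.2 Prop. 6.3; cell vocabulary] -/
theorem ShellCheckpoints.toEpochCheckpoints {ε₀ θ c : ℝ} {m : ℕ} {i₀ : Fin m} {n₀ : ℤ}
    {X₀ : Fin m → ℝ} {P : (Fin m → ℤ → ℝ) → (Fin m → ℤ → ℝ) → Prop} {N : ℤ}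
    {X E : Fin m → ℤ → ℝ → ℝ} {t e : ℤ → ℝ} (h : ShellCheckpoints ε₀ θ c i₀ n₀ X₀ P N X E t e) :
    EpochCheckpoints ε₀ θ c i₀ n₀ X₀ P (fun _ _ => True) N X E t e where
  toShellCheckpoints := h
  epoch _ _ _ _ _ := trivial

/-! ### The single-scale-ratio local robust checkpoint induction -/

/-- **`DynamicsLocalAt ε₀ R` — the local robust transition-state induction at ONE scale ratio
`1+ε₀` for the comparable class with spread `R`** (the cell's "Prop. 6.4-loc" matrix; compare Tao's
Prop. 6.4, the inductive step `N ↦ N+1` of Prop. 6.3): some `R`-comparable symmetric cancelling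
four-mode table `α`, one-shell datum `X₀` (observable mode `i₀` charged), transition-state
description `P` and epoch description `Q`, with ratio exponent `0 ≤ θ < 5/2` and clock constant
`c > 0` (`θ ≥ 0` and the strict clock exclude the degenerate witnesses "amplitudes forced to grow" and
"zero lifespan"), satisfy: (base) `P` holds at the rescaled datum; (step) for all implied constants
`K₁, K₂ ≥ 0` and all large `n₀`, along every LOCAL pseudo-solution on `[0,T]`, epoch checkpoints up
to level `N` whose next lifespan fits inside `[0,T]` extend to level `N+1`. Non-vacuous (local
pseudo-solutions exist). A predicate on `(ε₀, R)`; nothing is asserted.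
[cite: Tao2016AveragedNS, §6.2–6.3 Props. 6.3–6.4 (statement shape); cell vocabulary] -/
def DynamicsLocalAt (ε₀ R : ℝ) : Prop :=
  ∃ (θ c : ℝ) (i₀ : Fin 4) (α : Fin 4 → Fin 4 → Fin 4 → ℤ × ℤ × ℤ → ℝ) (X₀ : Fin 4 → ℝ)
    (P Q : (Fin 4 → ℤ → ℝ) → (Fin 4 → ℤ → ℝ) → Prop),
    0 ≤ θ ∧ θ < 5 / 2 ∧ 0 < c ∧ InTableClass R α ∧ X₀ i₀ ≠ 0 ∧
      P (datumState i₀ X₀) (datumEnergy i₀ X₀) ∧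
      ∀ K₁ K₂ : ℝ, 0 ≤ K₁ → 0 ≤ K₂ → ∃ N₀ : ℤ, ∀ n₀ : ℤ, N₀ ≤ n₀ →
        ∀ T : ℝ, 0 < T → ∀ X E : Fin 4 → ℤ → ℝ → ℝ,
          CascadeODESolutionOn T ε₀ α K₁ K₂ n₀ X₀ X E →
            ∀ N : ℤ, n₀ ≤ N → ∀ t e : ℤ → ℝ, EpochCheckpoints ε₀ θ c i₀ n₀ X₀ P Q N X E t e →
              t N + c * (1 + ε₀) ^ (-(5 : ℝ) * N / 2) * (e N)⁻¹ ≤ T →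
                ∃ s a : ℝ, EpochCheckpoints ε₀ θ c i₀ n₀ X₀ P Q (N + 1) X E
                  (Function.update t (N + 1) s) (Function.update e (N + 1) a)

/-! ### Restarted pseudo-flows (the rescaled system of Prop. 6.5) and the restart at a checkpoint

SCALE COVARIANCE (Tao §6.4, used at every checkpoint). If `(X, E)` obeys (4.8)–(4.10) with
constants `(K₁, K₂)` and `(N, t_N, e_N)` is a checkpoint, then
`S_{i,k}(s) := X_{i,N+k}(t_N + s/γ)/e_N`, `F_{i,k}(s) := E_{i,N+k}(t_N + s/γ)/e_N²` with
`γ := e_N (1+ε₀)^{5N/2}` obey the SAME displays at level `0` with constants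
`κ_j = K_j e_N⁻¹ (1+ε₀)^{-N/2}` (Tao: "the factors `(1+ε₀)^{2k−n₀/2}` replaced by
`(1+ε₀)^{2k−N/2} e_N⁻¹`") and with the accumulated (4.10)-slack
`B₀_{i,k} = K₂ (1+ε₀)^{2(N+k)} (∫₀^{t_N} E_{i,N+k}) / e_N²` added to (4.10). -/

/-- The epoch description "energies under the envelope `env`": `F_{i,k} ≤ env k` for all modes and
shell offsets (relative to level `n-1`, amplitude `e_{n-1}`). Tao's (ix) is the envelope
`env k = K⁻¹⁰(1+ε₀)^{|k|/10}` for `k ≤ -2`, `1` on `{-1, 0}` (there as the sum `Ẽ_{-1}+Ẽ_0 ≤ 1`),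
`K⁻³⁰(1+ε₀)^{-10k}` for `k ≥ 1`. [cite: Tao2016AveragedNS, §6.2 Prop. 6.3 (ix); cell vocabulary] -/
def epochEnvelope {m : ℕ} (env : ℤ → ℝ) : (Fin m → ℤ → ℝ) → (Fin m → ℤ → ℝ) → Prop :=
  fun _ F => ∀ i k, F i k ≤ env k

/-- **A restarted local pseudo-flow on `[0, τ]`** for the table `α` at scale ratio `1+ε₀`: the
displays (4.5), (4.8), (4.9), (4.10) of Lemma 4.1 at level `0` and amplitude `1`, with defect
constants `κ₁, κ₂`, an ARBITRARY start state `(S₀, F₀)` and an accumulated (4.10)-slack `B₀` (no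
"no-low-frequency" clause: after a restart the shells below the datum are `k < n₀ - N`). With
`κ₁ = κ₂ = 0`, `B₀ = 0`, `F₀ = ½S₀²` this is an EXACT local solution of the inviscid lattice
(possibly carrying inert phantom energy `F - ½S²`). Compare Tao's rescaled system, Prop. 6.5
(i), (ii), (iv), where `κ_j = O((1+ε₀)^{-n₀/2})`.
[cite: Tao2016AveragedNS, §4 Lemma 4.1 (4.5), (4.8)–(4.10) and §6.4 Prop. 6.5 (i), (ii), (iv); cell vocabulary] -/
structure PseudoFlowOn (τ ε₀ : ℝ) {m : ℕ} (α : Fin m → Fin m → Fin m → ℤ × ℤ × ℤ → ℝ) (κ₁ κ₂ : ℝ)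
    (S₀ F₀ B₀ : Fin m → ℤ → ℝ) (S F : Fin m → ℤ → ℝ → ℝ) : Prop where
  /-- `S_{i,k}` is continuously differentiable on `[0,τ]`. -/
  contDiffOn_S : ∀ i k, ContDiffOn ℝ 1 (S i k) (Icc 0 τ)
  /-- `F_{i,k}` is continuously differentiable on `[0,τ]`. -/
  contDiffOn_F : ∀ i k, ContDiffOn ℝ 1 (F i k) (Icc 0 τ)
  /-- `F_{i,k} ≥ 0` on `[0,τ]`. -/
  nonneg_F : ∀ i k s, s ∈ Icc 0 τ → 0 ≤ F i k s
  /-- (4.5), amplitudes, on `[0,τ]` (qualitative). -/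
  apriori_S : ∃ M : ℝ, ∀ s ∈ Icc 0 τ, ∀ (i : Fin m) (k : ℤ),
    (1 + (1 + ε₀) ^ ((10 : ℝ) * k)) * |S i k s| ≤ M
  /-- (4.5), energies, on `[0,τ]` (qualitative). -/
  apriori_F : ∃ M : ℝ, ∀ s ∈ Icc 0 τ, ∀ (i : Fin m) (k : ℤ),
    (1 + (1 + ε₀) ^ ((10 : ℝ) * k)) * Real.sqrt (F i k s) ≤ M
  /-- start state, amplitudes. -/
  init_S : ∀ i k, S i k 0 = S₀ i k
  /-- start state, energies. -/
  init_F : ∀ i k, F i k 0 = F₀ i k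
  /-- (4.8) with defect constant `κ₁` (one-sided derivative within `[0,τ]`). -/
  motion : ∀ i k s, s ∈ Icc 0 τ →
    |derivWithin (S i k) (Icc 0 τ) s - quadTerm ε₀ α S i k s| ≤
      κ₁ * (1 + ε₀) ^ ((2 : ℝ) * k) * Real.sqrt (F i k s)
  /-- (4.9). -/
  energy : ∀ i k s, s ∈ Icc 0 τ →
    derivWithin (F i k) (Icc 0 τ) s ≤ quadTerm ε₀ α S i k s * S i k s
  /-- (4.10), lower. -/
  defect_lower : ∀ i k s, s ∈ Icc 0 τ → (1 / 2) * S i k s ^ 2 ≤ F i k s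
  /-- (4.10), upper, with the accumulated slack `B₀` and defect constant `κ₂`. -/
  defect_upper : ∀ i k s, s ∈ Icc 0 τ →
    F i k s ≤ (1 / 2) * S i k s ^ 2 + B₀ i k +
      κ₂ * (1 + ε₀) ^ ((2 : ℝ) * k) * ∫ u in (0 : ℝ)..s, F i k u

/-- **One checkpoint step of a restarted flow** (level `0`, amplitude `1`, time `0` ↦ level `1`,
time `τ₁`, amplitude `a`): clock `0 < τ₁ ≤ c`, ratio `(1+ε₀)^{-θ} ≤ a` (and `a > 0`), amplitude
`a ≤ |S_{i₀,1}(τ₁)|`, the transition-state description `P` at the level-`1` rescaled state, and the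
epoch description `Q` throughout `[0, τ₁]`. Compare the conclusion `(τ₁, μ₁)` of Tao's Prop. 6.5.
[cite: Tao2016AveragedNS, §6.4 Prop. 6.5 (conclusion) and §6.2 Prop. 6.3 (vii)–(ix); cell vocabulary] -/
def StepTo (ε₀ θ c : ℝ) {m : ℕ} (i₀ : Fin m) (P Q : (Fin m → ℤ → ℝ) → (Fin m → ℤ → ℝ) → Prop)
    (S F : Fin m → ℤ → ℝ → ℝ) (τ₁ a : ℝ) : Prop :=
  0 < τ₁ ∧ τ₁ ≤ c ∧ 0 < a ∧ (1 + ε₀) ^ (-θ) ≤ a ∧ a ≤ |S i₀ 1 τ₁| ∧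
    P (fun i k => S i (1 + k) τ₁ / a) (fun i k => F i (1 + k) τ₁ / a ^ 2) ∧
    ∀ s ∈ Icc 0 τ₁, Q (fun i k => S i k s) (fun i k => F i k s)

/-- **The canonical slack envelope** after `L` past epochs with clock constant `c`, ratio exponent
`θ` and epoch energy envelope `env`:
`slackWeight L k = c (1+ε₀)^{2k} ∑_{d=1}^{L} (1+ε₀)^{(5/2+θ)d} env (k+d)` — the bound on the
rescaled accumulated (4.10)-slack of shell `N+k` at checkpoint `N = n₀ + L`, per unit of
`κ₂ = K₂ e_N⁻¹(1+ε₀)^{-N/2}` (epoch `j` contributes `≤ c(1+ε₀)^{-5(j-1)/2} e_{j-1} env(N+k-j+1)`,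
and `e_{j-1} ≤ (1+ε₀)^{θ(N-j+1)} e_N`; compare Tao's Lemma 6.7, the cumulative energy bound). Finite
sums only. [cite: Tao2016AveragedNS, §6.4 Lemma 6.7 (cumulative energy bound) with §4 (4.10); cell vocabulary] -/
def slackWeight (ε₀ θ c : ℝ) (env : ℤ → ℝ) (L : ℕ) (k : ℤ) : ℝ :=
  c * (1 + ε₀) ^ ((2 : ℝ) * k) *
    ∑ d ∈ Finset.Icc 1 L, (1 + ε₀) ^ ((5 / 2 + θ) * (d : ℝ)) * env (k + d)

/-- The restarted amplitudes at the checkpoint `(N, t_N, e_N)`: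
`S_{i,k}(s) = X_{i,N+k}(t_N + s/γ)/e_N`, `γ = e_N (1+ε₀)^{5N/2}` (Tao's `a_k, b_k, c_k, d_k`).
[cite: Tao2016AveragedNS, §6.4 (the rescaled solutions `a_k(t) := e_N⁻¹ X_{1,N+k}(t_N + (1+ε₀)^{-5N/2} e_N⁻¹ t)`); cell vocabulary] -/
def restartX {m : ℕ} (ε₀ : ℝ) (N : ℤ) (tN eN : ℝ) (X : Fin m → ℤ → ℝ → ℝ) :
    Fin m → ℤ → ℝ → ℝ :=
  fun i k s => X i (N + k) (tN + s / (eN * (1 + ε₀) ^ ((5 : ℝ) * N / 2))) / eN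

/-- The restarted energies `F_{i,k}(s) = E_{i,N+k}(t_N + s/γ)/e_N²` (Tao's `Ẽ_k`).
[cite: Tao2016AveragedNS, §6.4 (the rescaled energies `Ẽ_k(t) := e_N⁻² E_{N+k}(…)`); cell vocabulary] -/
def restartE {m : ℕ} (ε₀ : ℝ) (N : ℤ) (tN eN : ℝ) (E : Fin m → ℤ → ℝ → ℝ) :
    Fin m → ℤ → ℝ → ℝ :=
  fun i k s => E i (N + k) (tN + s / (eN * (1 + ε₀) ^ ((5 : ℝ) * N / 2))) / eN ^ 2

/-- The rescaled accumulated (4.10)-slack `B₀_{i,k} = K₂ (1+ε₀)^{2(N+k)} (∫₀^{t_N} E_{i,N+k}) / e_N²`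
(the part of the time integral in (4.10) accrued before the checkpoint, in restarted units).
[cite: Tao2016AveragedNS, §4 (4.10) and §6.4 Prop. 6.5 (iv); cell vocabulary] -/
def restartSlack {m : ℕ} (ε₀ K₂ : ℝ) (N : ℤ) (tN eN : ℝ) (E : Fin m → ℤ → ℝ → ℝ) :
    Fin m → ℤ → ℝ :=
  fun i k => K₂ * (1 + ε₀) ^ ((2 : ℝ) * ((N : ℝ) + k)) * (∫ u in (0 : ℝ)..tN, E i (N + k) u) / eN ^ 2

/-- At restarted time `0` the restarted amplitudes are the rescaled checkpoint state.
[cite: Tao2016AveragedNS, §6.4; cell vocabulary] -/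
theorem restartX_zero {m : ℕ} (ε₀ : ℝ) (N : ℤ) (tN eN : ℝ) (X : Fin m → ℤ → ℝ → ℝ)
    (i : Fin m) (k : ℤ) : restartX ε₀ N tN eN X i k 0 = X i (N + k) tN / eN := by
  simp [restartX]

/-- At restarted time `0` the restarted energies are the rescaled checkpoint energies.
[cite: Tao2016AveragedNS, §6.4; cell vocabulary] -/
theorem restartE_zero {m : ℕ} (ε₀ : ℝ) (N : ℤ) (tN eN : ℝ) (E : Fin m → ℤ → ℝ → ℝ)
    (i : Fin m) (k : ℤ) : restartE ε₀ N tN eN E i k 0 = E i (N + k) tN / eN ^ 2 := by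
  simp [restartE]

/-! ### Robust front steps with margin `η` -/

/-- **(front) — defect-free flows exist on the clock window.** From every start state in `P` with
admissible slack `0 ≤ B₀ ≤ η · slackWeight L` (any number `L` of past epochs) and compatible start
energies `½S₀² ≤ F₀ ≤ ½S₀² + B₀` there EXISTS a defect-free flow (`κ₁ = κ₂ = 0`) on the whole
clock window `[0, c]`. This is the clause that makes a front step non-vacuous: a witness cannot
choose the clock longer than the lifespan of the flows it must control.
[cite: Tao2016AveragedNS, §4 Lemma 4.1 (4.5), (4.8)–(4.10) (displays); cell vocabulary] -/
def FrontExists (ε₀ θ c η : ℝ) {m : ℕ} (α : Fin m → Fin m → Fin m → ℤ × ℤ × ℤ → ℝ)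
    (P : (Fin m → ℤ → ℝ) → (Fin m → ℤ → ℝ) → Prop) (env : ℤ → ℝ) : Prop :=
  ∀ (L : ℕ) (S₀ F₀ B₀ : Fin m → ℤ → ℝ), P S₀ F₀ →
    (∀ i k, 0 ≤ B₀ i k ∧ B₀ i k ≤ η * slackWeight ε₀ θ c env L k) →
    (∀ i k, (1 / 2) * S₀ i k ^ 2 ≤ F₀ i k ∧ F₀ i k ≤ (1 / 2) * S₀ i k ^ 2 + B₀ i k) →
      ∃ S F : Fin m → ℤ → ℝ → ℝ, PseudoFlowOn c ε₀ α 0 0 S₀ F₀ B₀ S F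

/-- **(step) — every `(η, η)`-pseudo-flow steps.** For every number `L` of past epochs, every start
state in `P` with slack `0 ≤ B₀ ≤ η · slackWeight L`, and every `(η, η)`-pseudo-flow from it on a
horizon `τ ≥ c`, there is a checkpoint step `StepTo` (clock `≤ c`, ratio `≥ (1+ε₀)^{-θ}`, new
state in `P`, energies under `env` during the epoch). Compare Tao's Prop. 6.5: the rescaled
inductive step with defects `O((1+ε₀)^{-n₀/2})`.
[cite: Tao2016AveragedNS, §6.4 Prop. 6.5 (statement shape); cell vocabulary] -/
def RobustStep (ε₀ θ c η : ℝ) {m : ℕ} (i₀ : Fin m) (α : Fin m → Fin m → Fin m → ℤ × ℤ × ℤ → ℝ)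
    (P : (Fin m → ℤ → ℝ) → (Fin m → ℤ → ℝ) → Prop) (env : ℤ → ℝ) : Prop :=
  ∀ (L : ℕ) (S₀ F₀ B₀ : Fin m → ℤ → ℝ), P S₀ F₀ →
    (∀ i k, 0 ≤ B₀ i k ∧ B₀ i k ≤ η * slackWeight ε₀ θ c env L k) →
      ∀ τ : ℝ, c ≤ τ → ∀ S F : Fin m → ℤ → ℝ → ℝ,
        PseudoFlowOn τ ε₀ α η η S₀ F₀ B₀ S F →
          ∃ τ₁ a : ℝ, StepTo ε₀ θ c i₀ P (epochEnvelope env) S F τ₁ a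

/-- **The single-`ε₀` FRONT STEP `FrontStepAt ε₀ R` ("exact-with-margin step").** At scale ratio
`1+ε₀`, some `R`-comparable symmetric cancelling four-mode table `α`, one-shell datum `X₀`
(observable mode `i₀`), transition-state description `P`, epoch energy envelope `env`, ratio
exponent `0 ≤ θ ≤ 1/2` (the weakest the restart bookkeeping allows), clock constant `c > 0` and
MARGIN `η > 0` satisfy: (base) `P` holds at the rescaled datum; (front) `FrontExists`; (step)
`RobustStep`. Per `ε₀` this is what a rigorous renormalisation (Poincaré-map) fixed-point
certificate with a contraction margin and tail bounds establishes. A predicate; nothing asserted.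
[cite: Tao2016AveragedNS, §6.3–6.4 Props. 6.4–6.5 (statement shape); cell vocabulary] -/
def FrontStepAt (ε₀ R : ℝ) : Prop :=
  ∃ (θ c η : ℝ) (i₀ : Fin 4) (α : Fin 4 → Fin 4 → Fin 4 → ℤ × ℤ × ℤ → ℝ) (X₀ : Fin 4 → ℝ)
    (P : (Fin 4 → ℤ → ℝ) → (Fin 4 → ℤ → ℝ) → Prop) (env : ℤ → ℝ),
    0 ≤ θ ∧ θ ≤ 1 / 2 ∧ 0 < c ∧ 0 < η ∧ InTableClass R α ∧ X₀ i₀ ≠ 0 ∧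
      P (datumState i₀ X₀) (datumEnergy i₀ X₀) ∧
      FrontExists ε₀ θ c η α P env ∧ RobustStep ε₀ θ c η i₀ α P env

/-- Unfolding `FrontStepAt` with both clauses spelled out.
[cite: Tao2016AveragedNS, §6.3–6.4 Props. 6.4–6.5 (statement shape); cell vocabulary] -/
theorem frontStepAt_iff (ε₀ R : ℝ) :
    FrontStepAt ε₀ R ↔
      ∃ (θ c η : ℝ) (i₀ : Fin 4) (α : Fin 4 → Fin 4 → Fin 4 → ℤ × ℤ × ℤ → ℝ) (X₀ : Fin 4 → ℝ)
        (P : (Fin 4 → ℤ → ℝ) → (Fin 4 → ℤ → ℝ) → Prop) (env : ℤ → ℝ),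
        0 ≤ θ ∧ θ ≤ 1 / 2 ∧ 0 < c ∧ 0 < η ∧ InTableClass R α ∧ X₀ i₀ ≠ 0 ∧
          P (datumState i₀ X₀) (datumEnergy i₀ X₀) ∧
          (∀ (L : ℕ) (S₀ F₀ B₀ : Fin 4 → ℤ → ℝ), P S₀ F₀ →
            (∀ i k, 0 ≤ B₀ i k ∧ B₀ i k ≤ η * slackWeight ε₀ θ c env L k) →
            (∀ i k, (1 / 2) * S₀ i k ^ 2 ≤ F₀ i k ∧ F₀ i k ≤ (1 / 2) * S₀ i k ^ 2 + B₀ i k) →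
              ∃ S F : Fin 4 → ℤ → ℝ → ℝ, PseudoFlowOn c ε₀ α 0 0 S₀ F₀ B₀ S F) ∧
          ∀ (L : ℕ) (S₀ F₀ B₀ : Fin 4 → ℤ → ℝ), P S₀ F₀ →
            (∀ i k, 0 ≤ B₀ i k ∧ B₀ i k ≤ η * slackWeight ε₀ θ c env L k) →
              ∀ τ : ℝ, c ≤ τ → ∀ S F : Fin 4 → ℤ → ℝ → ℝ,
                PseudoFlowOn τ ε₀ α η η S₀ F₀ B₀ S F →
                  ∃ τ₁ a : ℝ, StepTo ε₀ θ c i₀ P (epochEnvelope env) S F τ₁ a :=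
  Iff.rfl

/-! ### Gap certificates: ball descriptions, the tail clause and gap data -/

/-- The BALL DESCRIPTION around a reference set `Z` of (rescaled) states: within weighted distance
`r` of some `z ∈ Z` (`w k` = weight of shell offset `k`; energies unconstrained — they are
controlled by the slack and the epoch envelope). [cite: Tao2016AveragedNS, §6.2 Prop. 6.3 (viii) (a transition-state description); cell vocabulary] -/
def ballDesc {m : ℕ} (Z : Set (Fin m → ℤ → ℝ)) (w : ℤ → ℝ) (r : ℝ) :
    (Fin m → ℤ → ℝ) → (Fin m → ℤ → ℝ) → Prop :=
  fun S _ => ∃ z ∈ Z, ∀ i k, w k * |S i k - z i k| ≤ r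

/-- Every reference state lies in the ball of any nonnegative radius around the reference set
(whatever its energies). [cite: Tao2016AveragedNS, §6.2 Prop. 6.3 (viii); cell vocabulary] -/
theorem ballDesc_of_mem {m : ℕ} {Z : Set (Fin m → ℤ → ℝ)} {w : ℤ → ℝ} {r : ℝ}
    {z : Fin m → ℤ → ℝ} (hz : z ∈ Z) (hr : 0 ≤ r) (F : Fin m → ℤ → ℝ) : ballDesc Z w r z F :=
  ⟨z, hz, fun i k => by simp [hr]⟩

/-- **TAIL CLAUSE** of gap data: beyond some shell offset `k₁` ahead of the front, (T1) the weight
grows super-geometrically, `w (k+1) ≥ 2(1+ε₀)^k · w k` — so the ball tolerance `r / w k` shrinks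
from one shell to the next by a factor that beats both the admissible amplitude ratios
`a ≥ (1+ε₀)^{-θ}` and the dissipation-scale factor `(1+ε₀)^{2k}` of the (4.10)-slack — and (T2)
every reference state's amplitude at such a shell is within a quarter of the tolerance of zero.
(Compare Tao's (ix): energies ahead of the front under `K⁻³⁰(1+ε₀)^{-10m}`.)
[cite: Tao2016AveragedNS, §6.2 Prop. 6.3 (ix) (energy estimates ahead of the front); cell vocabulary] -/
def TailFat (ε₀ : ℝ) {m : ℕ} (Z : Set (Fin m → ℤ → ℝ)) (w : ℤ → ℝ) (r : ℝ) : Prop :=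
  ∃ k₁ : ℤ, ∀ k : ℤ, k₁ ≤ k →
    2 * (1 + ε₀) ^ (k : ℝ) * w k ≤ w (k + 1) ∧ ∀ z ∈ Z, ∀ i : Fin m, 4 * (w k * |z i k|) ≤ r

/-- **GAP DATA at scale ratio `1+ε₀`** for a table `α`, datum `X₀` (observable mode `i₀`), reference
set `Z`, weight `w`, radius `r`, contraction factor `ρ`, ratio exponents `θ₀ < θ ≤ 1/2`, clocks
`c₀ < c` and exact epoch envelope `env₀`: (data) signs and margins `0 < r`, `0 ≤ ρ < 1`,
`0 ≤ θ₀ < θ ≤ 1/2`, `0 < c₀ < c`, weights `w ≥ 1`, the rescaled datum state lies in `Z`, the tail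
clause `TailFat`; (exist₀) from every state in the `r`-ball the DEFECT-FREE flow with zero slack
and start energies `½S₀²` exists on the whole clock window `[0, c]`; (step₀) every defect-free
zero-slack flow on a horizon `≥ c₀` from the `r`-ball steps — within the clock `c₀`, with amplitude
ratio `≥ (1+ε₀)^{-θ₀}` — into the `ρ r`-ball, with energies under `env₀` during the epoch. This is
what an interval certificate for the one-shift renormalisation map of one table establishes. A
predicate (the SHAPE of a certificate); nothing is asserted.
[cite: Tao2016AveragedNS, §6.3–6.4 Props. 6.4–6.5 (statement shape); cell vocabulary] -/
def GapData (ε₀ : ℝ) {m : ℕ} (i₀ : Fin m) (α : Fin m → Fin m → Fin m → ℤ × ℤ × ℤ → ℝ)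
    (X₀ : Fin m → ℝ) (Z : Set (Fin m → ℤ → ℝ)) (w : ℤ → ℝ) (r ρ θ₀ θ c₀ c : ℝ)
    (env₀ : ℤ → ℝ) : Prop :=
  0 < r ∧ 0 ≤ ρ ∧ ρ < 1 ∧ 0 ≤ θ₀ ∧ θ₀ < θ ∧ θ ≤ 1 / 2 ∧ 0 < c₀ ∧ c₀ < c ∧ (∀ k, 1 ≤ w k) ∧
    datumState i₀ X₀ ∈ Z ∧ TailFat ε₀ Z w r ∧
    (∀ S₀ : Fin m → ℤ → ℝ, ballDesc Z w r S₀ (fun i k => (1 / 2) * S₀ i k ^ 2) →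
      ∃ S F : Fin m → ℤ → ℝ → ℝ,
        PseudoFlowOn c ε₀ α 0 0 S₀ (fun i k => (1 / 2) * S₀ i k ^ 2) (fun _ _ => 0) S F) ∧
    ∀ (S₀ : Fin m → ℤ → ℝ) (τ : ℝ) (S F : Fin m → ℤ → ℝ → ℝ),
      ballDesc Z w r S₀ (fun i k => (1 / 2) * S₀ i k ^ 2) → c₀ ≤ τ →
        PseudoFlowOn τ ε₀ α 0 0 S₀ (fun i k => (1 / 2) * S₀ i k ^ 2) (fun _ _ => 0) S F →
          ∃ τ₁ a : ℝ, StepTo ε₀ θ₀ c₀ i₀ (ballDesc Z w (ρ * r)) (epochEnvelope env₀) S F τ₁ a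

/-- The sign and margin conjuncts of gap data. [cite: Tao2016AveragedNS, §6.3–6.4 (statement shape); cell vocabulary] -/
theorem GapData.signs {ε₀ : ℝ} {m : ℕ} {i₀ : Fin m} {α : Fin m → Fin m → Fin m → ℤ × ℤ × ℤ → ℝ}
    {X₀ : Fin m → ℝ} {Z : Set (Fin m → ℤ → ℝ)} {w : ℤ → ℝ} {r ρ θ₀ θ c₀ c : ℝ} {env₀ : ℤ → ℝ}
    (h : GapData ε₀ i₀ α X₀ Z w r ρ θ₀ θ c₀ c env₀) :
    0 < r ∧ 0 ≤ ρ ∧ ρ < 1 ∧ 0 ≤ θ₀ ∧ θ₀ < θ ∧ θ ≤ 1 / 2 ∧ 0 < c₀ ∧ c₀ < c ∧ ∀ k, 1 ≤ w k :=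
  ⟨h.1, h.2.1, h.2.2.1, h.2.2.2.1, h.2.2.2.2.1, h.2.2.2.2.2.1, h.2.2.2.2.2.2.1, h.2.2.2.2.2.2.2.1,
    h.2.2.2.2.2.2.2.2.1⟩

/-- The rescaled datum satisfies the ball description of gap data (it lies in the reference set).
[cite: Tao2016AveragedNS, §6.2 (6.9)–(6.10) (initialisation); cell vocabulary] -/
theorem GapData.datum_mem_ball {ε₀ : ℝ} {m : ℕ} {i₀ : Fin m}
    {α : Fin m → Fin m → Fin m → ℤ × ℤ × ℤ → ℝ} {X₀ : Fin m → ℝ} {Z : Set (Fin m → ℤ → ℝ)}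
    {w : ℤ → ℝ} {r ρ θ₀ θ c₀ c : ℝ} {env₀ : ℤ → ℝ}
    (h : GapData ε₀ i₀ α X₀ Z w r ρ θ₀ θ c₀ c env₀) (F : Fin m → ℤ → ℝ) :
    ballDesc Z w r (datumState i₀ X₀) F :=
  ballDesc_of_mem h.2.2.2.2.2.2.2.2.2.1 h.1.le F


/-! ### Certificate format v2 (`GapData₂`): behind-tameness, step slack, two-sided tail -/

/-- **BEHIND/ACTIVE TAMENESS** of the reference set and the weight: reference amplitudes are
uniformly bounded at and ahead of the front and grow at most like `(1+ε₀)^{|k|}` behind it, and the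
weights grow at most like `(1+ε₀)^{|k|}` behind (`k ≤ 0`). Together these give the discounted
drain bound `(1+ε₀)^{2k} w(k−1) |z i k| ≤ C'` and the transport bounds used by a robust front
step. (Compare Tao's (viii)–(ix): the transition-state description behind the front and the
energy estimates ahead of it.) A predicate; nothing is asserted.
[cite: Tao2016AveragedNS, §6.2 Prop. 6.3 (viii)–(ix) (statement shape); cell vocabulary, certificate format v2] -/
def TameBehind (ε₀ : ℝ) {m : ℕ} (Z : Set (Fin m → ℤ → ℝ)) (w : ℤ → ℝ) : Prop :=
  ∃ C : ℝ, (∀ z ∈ Z, ∀ (i : Fin m) (k : ℤ), |z i k| ≤ C * (1 + (1 + ε₀) ^ (-(k : ℝ)))) ∧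
    ∀ k : ℤ, k ≤ 0 → w k ≤ C * (1 + ε₀) ^ (-(k : ℝ))

/-- **AMPLITUDE SLACK `σ` IN THE EXACT STEP**: the clause (step₀) of `GapData` with the extra
conjunct `(1+σ)·a ≤ |S i₀ 1 τ₁|` — the landing amplitude exceeds the certified ratio `a` by the
factor `1+σ`, so that an `O(η)`-perturbed flow can be rescaled by the SAME `a`. Implies (step₀).
A predicate; nothing is asserted.
[cite: Tao2016AveragedNS, §6.3–6.4 Props. 6.4–6.5 (statement shape, amplitude ratio of the inductive step); cell vocabulary, certificate format v2] -/
def StepSlack (σ ε₀ : ℝ) {m : ℕ} (i₀ : Fin m) (α : Fin m → Fin m → Fin m → ℤ × ℤ × ℤ → ℝ)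
    (Z : Set (Fin m → ℤ → ℝ)) (w : ℤ → ℝ) (r ρ θ₀ c₀ : ℝ) (env₀ : ℤ → ℝ) : Prop :=
  ∀ (S₀ : Fin m → ℤ → ℝ) (τ : ℝ) (S F : Fin m → ℤ → ℝ → ℝ),
    ballDesc Z w r S₀ (fun i k => (1 / 2) * S₀ i k ^ 2) → c₀ ≤ τ →
      PseudoFlowOn τ ε₀ α 0 0 S₀ (fun i k => (1 / 2) * S₀ i k ^ 2) (fun _ _ => 0) S F →
        ∃ τ₁ a : ℝ, StepTo ε₀ θ₀ c₀ i₀ (ballDesc Z w (ρ * r)) (epochEnvelope env₀) S F τ₁ a ∧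
          (1 + σ) * a ≤ |S i₀ 1 τ₁|

/-- **TWO-SIDED TAIL CLAUSE**: beyond ONE threshold `k₁` ahead of the front, (T1)
`2(1+ε₀)^k w k ≤ w (k+1)` and (T2) `4 w k |z i k| ≤ r` of `TailFat`, together with the envelope
scale `env₀ k ≤ K₀ r²/w(k−1)²` (the exact epoch envelope sits at the shifted tolerance scale) and
the UPPER growth `(1+ε₀)^{5(k+2)/2} r w(k+1) ≤ C₄ (w k)²` (the energy pumped from a shell at its
tolerance fits the next shell's tolerance within one clock window). Gaussian weights
`2^{k²/2+bk}`, `b ≥ 1/2`, satisfy all four. A predicate; nothing is asserted.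
[cite: Tao2016AveragedNS, §6.2 Prop. 6.3 (ix) (energy estimates ahead of the front, statement shape); cell vocabulary, certificate format v2] -/
def TailCompat (ε₀ : ℝ) {m : ℕ} (Z : Set (Fin m → ℤ → ℝ)) (w : ℤ → ℝ) (r : ℝ) (env₀ : ℤ → ℝ) :
    Prop :=
  ∃ (k₁ : ℤ) (K₀ C₄ : ℝ), ∀ k : ℤ, k₁ ≤ k →
    2 * (1 + ε₀) ^ (k : ℝ) * w k ≤ w (k + 1) ∧ (∀ z ∈ Z, ∀ i : Fin m, 4 * (w k * |z i k|) ≤ r) ∧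
      env₀ k ≤ K₀ * r ^ 2 / w (k - 1) ^ 2 ∧
        (1 + ε₀) ^ ((5 : ℝ) * (k + 2) / 2) * r * w (k + 1) ≤ C₄ * w k ^ 2

/-- **GAP DATA, FORMAT v2** = gap data (`GapData`) ∧ a slack `σ > 0` ∧ behind tameness
(`TameBehind`) ∧ the exact step with slack (`StepSlack`) ∧ the two-sided tail (`TailCompat`). The
v1 predicate is untouched; every v1 consumer reads a v2 certificate through `GapData₂.toGapData`.
A predicate (the SHAPE of a certificate); nothing is asserted.
[cite: Tao2016AveragedNS, §6.3–6.4 Props. 6.4–6.5 (statement shape); cell vocabulary, certificate format v2] -/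
def GapData₂ (σ ε₀ : ℝ) {m : ℕ} (i₀ : Fin m) (α : Fin m → Fin m → Fin m → ℤ × ℤ × ℤ → ℝ)
    (X₀ : Fin m → ℝ) (Z : Set (Fin m → ℤ → ℝ)) (w : ℤ → ℝ) (r ρ θ₀ θ c₀ c : ℝ)
    (env₀ : ℤ → ℝ) : Prop :=
  GapData ε₀ i₀ α X₀ Z w r ρ θ₀ θ c₀ c env₀ ∧ 0 < σ ∧ TameBehind ε₀ Z w ∧
    StepSlack σ ε₀ i₀ α Z w r ρ θ₀ c₀ env₀ ∧ TailCompat ε₀ Z w r env₀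

/-- v2 gap data is v1 gap data (so `GapData.signs`, `GapData.datum_mem_ball` apply through `.1`).
[cite: Tao2016AveragedNS, §6.3–6.4 (statement shape); cell vocabulary, certificate format v2] -/
theorem GapData₂.toGapData {σ ε₀ : ℝ} {m : ℕ} {i₀ : Fin m}
    {α : Fin m → Fin m → Fin m → ℤ × ℤ × ℤ → ℝ} {X₀ : Fin m → ℝ} {Z : Set (Fin m → ℤ → ℝ)}
    {w : ℤ → ℝ} {r ρ θ₀ θ c₀ c : ℝ} {env₀ : ℤ → ℝ}
    (h : GapData₂ σ ε₀ i₀ α X₀ Z w r ρ θ₀ θ c₀ c env₀) :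
    GapData ε₀ i₀ α X₀ Z w r ρ θ₀ θ c₀ c env₀ := h.1

/-- The slack conjunct of v2 gap data. [cite: Tao2016AveragedNS, §6.3–6.4 (statement shape); cell vocabulary, certificate format v2] -/
theorem GapData₂.slack_pos {σ ε₀ : ℝ} {m : ℕ} {i₀ : Fin m}
    {α : Fin m → Fin m → Fin m → ℤ × ℤ × ℤ → ℝ} {X₀ : Fin m → ℝ} {Z : Set (Fin m → ℤ → ℝ)}
    {w : ℤ → ℝ} {r ρ θ₀ θ c₀ c : ℝ} {env₀ : ℤ → ℝ}
    (h : GapData₂ σ ε₀ i₀ α X₀ Z w r ρ θ₀ θ c₀ c env₀) : 0 < σ := h.2.1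

/-- The two-sided tail clause implies the one-sided tail clause `TailFat`.
[cite: Tao2016AveragedNS, §6.2 Prop. 6.3 (ix) (statement shape); cell vocabulary, certificate format v2] -/
theorem TailCompat.tailFat {ε₀ : ℝ} {m : ℕ} {Z : Set (Fin m → ℤ → ℝ)} {w : ℤ → ℝ} {r : ℝ}
    {env₀ : ℤ → ℝ} (h : TailCompat ε₀ Z w r env₀) : TailFat ε₀ Z w r := by
  obtain ⟨k₁, K₀, C₄, hk⟩ := h
  exact ⟨k₁, fun k hk' => ⟨(hk k hk').1, (hk k hk').2.1⟩⟩

/-- The exact step with slack implies the exact step (step₀) of `GapData` (drop the slack conjunct).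
[cite: Tao2016AveragedNS, §6.3–6.4 Props. 6.4–6.5 (statement shape); cell vocabulary, certificate format v2] -/
theorem StepSlack.step {σ ε₀ : ℝ} {m : ℕ} {i₀ : Fin m}
    {α : Fin m → Fin m → Fin m → ℤ × ℤ × ℤ → ℝ} {Z : Set (Fin m → ℤ → ℝ)} {w : ℤ → ℝ}
    {r ρ θ₀ c₀ : ℝ} {env₀ : ℤ → ℝ} (h : StepSlack σ ε₀ i₀ α Z w r ρ θ₀ c₀ env₀)
    (S₀ : Fin m → ℤ → ℝ) (τ : ℝ) (S F : Fin m → ℤ → ℝ → ℝ)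
    (hball : ballDesc Z w r S₀ (fun i k => (1 / 2) * S₀ i k ^ 2)) (hτ : c₀ ≤ τ)
    (hflow : PseudoFlowOn τ ε₀ α 0 0 S₀ (fun i k => (1 / 2) * S₀ i k ^ 2) (fun _ _ => 0) S F) :
    ∃ τ₁ a : ℝ, StepTo ε₀ θ₀ c₀ i₀ (ballDesc Z w (ρ * r)) (epochEnvelope env₀) S F τ₁ a := by
  obtain ⟨τ₁, a, h1, -⟩ := h S₀ τ S F hball hτ hflow
  exact ⟨τ₁, a, h1⟩

/-! ### Certificate format v2, thin-tail supplement (cell harvest/h2-tao-ladder, p1 g9, 2026-08-27)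

`TailCompat` bounds the hand-over quantity `(1+ε₀)^{5(k+2)/2} r w(k+1) / (w k)²` by SOME constant
`C₄`. The one-directional energy induction over the far tail of the (step) clause (tree:
`Summit.….Theorems.GappedFrontRobust.pseudoFlowOn_abs_le_tail_step`) contracts only where
`c · (∑|α_{·,(0,0,1)}|) ·` that quantity is SMALL: an `(η, η)`-pseudo-flow has full sign control at
the shells where `η (1+ε₀)^{2k} ≥ 1` — infinitely many for every `η > 0` — and can rectify the bond
flux `botSum(k-1)` there, gaining up to `Λ_{k-1} (∫|Π(S_{k-1})| − |∫Π(S_{k-1})|)` over the exact flow,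
i.e. up to `O(K₀ c ∑|α|) · C₄` tolerances. The limit clause below removes the dependence on the size
of `C₄`; Gaussian-type weights `w k = C · 2^{k²/2 + b k}` satisfy it (the quantity decays
super-geometrically). It is meant as an extra hypothesis of the format-v2 perturbation statement and an
extra conjunct of the format-v2 certificate statements; `GapData₂` is untouched. -/

/-- **THIN TAIL** (format v2 supplement, clause H4b′ = the limit form of `TailCompat`'s upper growth
bound): for every `ϑ > 0` there is a shell offset `k₂` beyond which
`(1+ε₀)^{5(k+2)/2} · r · w(k+1) ≤ ϑ · (w k)²`. A predicate on `(ε₀, w, r)`; nothing is asserted.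
[cite: Tao2016AveragedNS, §6.2 Prop. 6.3 (ix) (energy estimates ahead of the front, statement shape); cell vocabulary, certificate format v2] -/
def TailThin (ε₀ : ℝ) (w : ℤ → ℝ) (r : ℝ) : Prop :=
  ∀ ϑ : ℝ, 0 < ϑ → ∃ k₂ : ℤ, ∀ k : ℤ, k₂ ≤ k →
    (1 + ε₀) ^ ((5 : ℝ) * (k + 2) / 2) * r * w (k + 1) ≤ ϑ * w k ^ 2

/-- Under the thin-tail clause the hand-over quantity is eventually below any positive threshold.
[cite: Tao2016AveragedNS, §6.2 Prop. 6.3 (ix) (statement shape); cell vocabulary, certificate format v2] -/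
theorem TailThin.eventually_le {ε₀ : ℝ} {w : ℤ → ℝ} {r : ℝ} (h : TailThin ε₀ w r) {ϑ : ℝ}
    (hϑ : 0 < ϑ) : ∃ k₂ : ℤ, ∀ k : ℤ, k₂ ≤ k →
      (1 + ε₀) ^ ((5 : ℝ) * (k + 2) / 2) * r * w (k + 1) ≤ ϑ * w k ^ 2 :=
  h ϑ hϑ

/-- A thin tail with threshold `ϑ` from `k₂` on gives the upper growth bound of `TailCompat` with
constant `ϑ` from `k₂` on (the bounded form is the weaker one).
[cite: Tao2016AveragedNS, §6.2 Prop. 6.3 (ix) (statement shape); cell vocabulary, certificate format v2] -/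
theorem TailThin.exists_bound {ε₀ : ℝ} {w : ℤ → ℝ} {r : ℝ} (h : TailThin ε₀ w r) :
    ∃ (k₂ : ℤ) (C₄ : ℝ), ∀ k : ℤ, k₂ ≤ k →
      (1 + ε₀) ^ ((5 : ℝ) * (k + 2) / 2) * r * w (k + 1) ≤ C₄ * w k ^ 2 := by
  obtain ⟨k₂, hk₂⟩ := h 1 one_pos
  exact ⟨k₂, 1, hk₂⟩

/-- The components of format-v2 gap data beyond `GapData`, as one conjunction.
[cite: Tao2016AveragedNS, §6.3–6.4 (statement shape); cell vocabulary, certificate format v2] -/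
theorem GapData₂.clauses {σ ε₀ : ℝ} {m : ℕ} {i₀ : Fin m}
    {α : Fin m → Fin m → Fin m → ℤ × ℤ × ℤ → ℝ} {X₀ : Fin m → ℝ} {Z : Set (Fin m → ℤ → ℝ)}
    {w : ℤ → ℝ} {r ρ θ₀ θ c₀ c : ℝ} {env₀ : ℤ → ℝ}
    (h : GapData₂ σ ε₀ i₀ α X₀ Z w r ρ θ₀ θ c₀ c env₀) :
    0 < σ ∧ TameBehind ε₀ Z w ∧ StepSlack σ ε₀ i₀ α Z w r ρ θ₀ c₀ env₀ ∧ TailCompat ε₀ Z w r env₀ :=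
  h.2

/-- The rescaled datum satisfies the ball description of format-v2 gap data.
[cite: Tao2016AveragedNS, §6.2 (6.9)–(6.10) (initialisation); cell vocabulary, certificate format v2] -/
theorem GapData₂.datum_mem_ball {σ ε₀ : ℝ} {m : ℕ} {i₀ : Fin m}
    {α : Fin m → Fin m → Fin m → ℤ × ℤ × ℤ → ℝ} {X₀ : Fin m → ℝ} {Z : Set (Fin m → ℤ → ℝ)}
    {w : ℤ → ℝ} {r ρ θ₀ θ c₀ c : ℝ} {env₀ : ℤ → ℝ}
    (h : GapData₂ σ ε₀ i₀ α X₀ Z w r ρ θ₀ θ c₀ c env₀) (F : Fin m → ℤ → ℝ) :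
    ballDesc Z w r (datumState i₀ X₀) F :=
  h.1.datum_mem_ball F

end TaoCascade

end Literature.Analysis.FluidPDE

end
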